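import Summits.BirchSwinnertonDyer.BirchSwinnertonDyer.Theorems.KolyvaginDepthDoorDepthTableRowsOfPrint2
import Summits.BirchSwinnertonDyer.BirchSwinnertonDyer.Theorems.KolyvaginDepthDoorDepthTableRowsOfPrint3
import Summits.BirchSwinnertonDyer.BirchSwinnertonDyer.Theorems.KolyvaginDepthDoorDepthTableRowsOfPrint4
import Summits.BirchSwinnertonDyer.BirchSwinnertonDyer.Theorems.KolyvaginDepthDoorDepthTableRowsOfPrint5
import Summits.BirchSwinnertonDyer.BirchSwinnertonDyer.Theorems.KolyvaginDepthDoorDepthTableRowsOfPrint6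
import Summits.BirchSwinnertonDyer.BirchSwinnertonDyer.Theorems.KolyvaginDepthDoorDepthTableRowKitVanishing
import HarnessLib

/-!
# Route `KolyvaginDepthDoor` — DEPTH-ZERO VANISHING ROWS of the depth table, rank-2 curves
# `681c1`, `707a1`, `794a1`, `817a1`, `997b1`, `997c1`, `664a1`, `916c1`:
# the class of the Heegner point `y_K` dies mod `p`, on (γ) ONLY — NO bit (crux `KolyvaginDepthSupply`,
# stmt-BirchSwinnertonDyer-21765) — part 2 of 2

Helper file (`--supports stmt-BirchSwinnertonDyer-21765 --as helper`); it closes nothing and BSD is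
not proved by it.

The 18 rank-2 rows `C<label>.depthRow_<p>_neg<D>_<ℓ>_print` (g8, files `…RowsPrint1–4`) read the depth-1
bit upward («`c_1(ℓ) ≠ 0` ⟹ `t_p = 0`, rank `= 2`»). These rows are their BIT-FREE companions one level
down, from the lower bound of `…KolyvaginDepthSupplyMinimalDepth` through the kit
`…DepthTableRowKitVanishing` (this seat): on a curve with two independent rational points the
depth-ZERO class `c_1(1)` — the image of `y_K = P(1)` in `H¹(K, E[p])` — VANISHES for ANY frame
`(Dt, β, ι)` and ANY datum of conductor `1` (`y_K ∈ pE(K) + E(K)_tors`; consistent with, but not using,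
`y_K` torsion at analytic rank `≥ 2`). Together with the bit rows: on these curves the minimal depth of
a non-zero level-1 class is EXACTLY `1 = rank − 1` iff the bit holds. Inputs per row: (γ) =
`GrossLMS1991.prop37_2_frobeniusCongruence` ONLY; every side condition (`p ∈ B(E)`, non-CM, `2 ≤ rank`,
Heegner hypothesis for `d_K`, (KN_p) from `Δ(E₀)`) is the kernel certificate already used by the bit row
of the same curve (`944e1`, off the Kodaira–Néron cell, is omitted). CONDITIONAL on (γ); per-curve; BSD
is not proved by it.
-/

set_option linter.dupNamespace false

noncomputable section

open scoped Classical NumberField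

namespace Summit.BirchSwinnertonDyer.BirchSwinnertonDyer.Theorems.KolyvaginDepthDoor

open Literature.NumberTheory.EllipticCurves Literature.NumberTheory.EllipticCurves.ModularForms
  Literature.NumberTheory.EllipticCurves.McCallum1991 WeierstrassCurve
open Summit.BirchSwinnertonDyer.BirchSwinnertonDyer.Rank2Observatory
open Summit.BirchSwinnertonDyer.BirchSwinnertonDyer.Rank1Residual

namespace C681c1

/-- **DEPTH-ZERO VANISHING ROW `681c1`, `(p, d_K) = (5, -83)` — NO bit.** For `E = 681c1` (rank `2`, two
independent points certified in the kernel), ANY imaginary quadratic `K` with `d_K = -83`, any frame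
`(Dt, β, ι)` and ANY Kolyvagin–Heegner datum `d` of conductor `1`, granted the ONE Literature fact (γ) =
Gross 1991 Prop. 3.7 (2): the depth-0 class VANISHES, `d.kolyvaginClass _ 1 = 0` — the class of the Heegner
point `y_K` dies in `H¹(K, E[5])` (depth `0 ≤ rank − 2`; `depthRowZero_vanishes_printKN_of_intModel_certificate`,
side conditions = the kernel certificates of the bit row `depthRow_5_neg83_19_print`). CONDITIONAL on (γ);
per-curve; BSD is not proved by it. [cite: Kolyvagin1991MathAnn, Thm. 2.3 and Thm. 4]
[cite: GrossLMS1991, Prop. 3.7 (2), §4 (P_1 = y_K), §10] [cite: CremonaAlgorithms1997, Table 1 (681c1)] -/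
theorem depthRowZero_vanishes_5_neg83_printKN
    (h372 : GrossLMS1991.prop37_2_frobeniusCongruence)
    (K : Type) [Field K] [NumberField K] (hK : IsImaginaryQuadratic K)
    (hD : NumberField.discr K = -83) :
    haveI := isElliptic_c681c1;
    haveI := isGloballyMinimal_c681c1;
    haveI : NeZero (((⟨0, -1, 1, 0, 2⟩ : WeierstrassCurve ℤ).map (Int.castRingHom ℚ)).conductorNorm ℤ) :=
      neZero_conductorNorm_of_isElliptic _;
    ∀ (Dt : ModularParametrizationData ((⟨0, -1, 1, 0, 2⟩ : WeierstrassCurve ℤ).map (Int.castRingHom ℚ))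
        (((⟨0, -1, 1, 0, 2⟩ : WeierstrassCurve ℤ).map (Int.castRingHom ℚ)).conductorNorm ℤ)) (β : ℤ)
      (ι : K →+* ℂ) (d : KolyvaginHeegnerData Dt β ι 1),
    d.kolyvaginClass (p := 5) (by norm_num) 1 = 0 := by
  haveI := isElliptic_c681c1
  haveI := isGloballyMinimal_c681c1
  haveI : NeZero (((⟨0, -1, 1, 0, 2⟩ : WeierstrassCurve ℤ).map (Int.castRingHom ℚ)).conductorNorm ℤ) :=
    neZero_conductorNorm_of_isElliptic _
  intro Dt β ι d
  haveI := Fact.mk (by norm_num : Nat.Prime 5)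
  exact depthRowZero_vanishes_printKN_of_intModel_certificate intModel h372 not_hasCM
    KernelCerts002.C681c1.two_le_rank 5 (by norm_num) hasSurjectiveModNGaloisRep_pow_5 K hK hD
    (by norm_num) (by norm_num) heegner_neg83
    (Δ₀ := -2043) (by decide +kernel) (B := 11) (by decide +kernel) (by decide +kernel)
    (fun _ _ ↦ Or.inl (by norm_num)) Dt β ι d

end C681c1

namespace C707a1

/-- **DEPTH-ZERO VANISHING ROW `707a1`, `(p, d_K) = (5, -19)` — NO bit.** For `E = 707a1` (rank `2`, two
independent points certified in the kernel), ANY imaginary quadratic `K` with `d_K = -19`, any frame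
`(Dt, β, ι)` and ANY Kolyvagin–Heegner datum `d` of conductor `1`, granted the ONE Literature fact (γ) =
Gross 1991 Prop. 3.7 (2): the depth-0 class VANISHES, `d.kolyvaginClass _ 1 = 0` — the class of the Heegner
point `y_K` dies in `H¹(K, E[5])` (depth `0 ≤ rank − 2`; `depthRowZero_vanishes_printKN_of_intModel_certificate`,
side conditions = the kernel certificates of the bit row `depthRow_5_neg19_179_print`). CONDITIONAL on (γ);
per-curve; BSD is not proved by it. [cite: Kolyvagin1991MathAnn, Thm. 2.3 and Thm. 4]
[cite: GrossLMS1991, Prop. 3.7 (2), §4 (P_1 = y_K), §10] [cite: CremonaAlgorithms1997, Table 1 (707a1)] -/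
theorem depthRowZero_vanishes_5_neg19_printKN
    (h372 : GrossLMS1991.prop37_2_frobeniusCongruence)
    (K : Type) [Field K] [NumberField K] (hK : IsImaginaryQuadratic K)
    (hD : NumberField.discr K = -19) :
    haveI := isElliptic_c707a1;
    haveI := isGloballyMinimal_c707a1;
    haveI : NeZero (((⟨0, 1, 1, -12, 12⟩ : WeierstrassCurve ℤ).map (Int.castRingHom ℚ)).conductorNorm ℤ) :=
      neZero_conductorNorm_of_isElliptic _;
    ∀ (Dt : ModularParametrizationData ((⟨0, 1, 1, -12, 12⟩ : WeierstrassCurve ℤ).map (Int.castRingHom ℚ))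
        (((⟨0, 1, 1, -12, 12⟩ : WeierstrassCurve ℤ).map (Int.castRingHom ℚ)).conductorNorm ℤ)) (β : ℤ)
      (ι : K →+* ℂ) (d : KolyvaginHeegnerData Dt β ι 1),
    d.kolyvaginClass (p := 5) (by norm_num) 1 = 0 := by
  haveI := isElliptic_c707a1
  haveI := isGloballyMinimal_c707a1
  haveI : NeZero (((⟨0, 1, 1, -12, 12⟩ : WeierstrassCurve ℤ).map (Int.castRingHom ℚ)).conductorNorm ℤ) :=
    neZero_conductorNorm_of_isElliptic _
  intro Dt β ι d
  haveI := Fact.mk (by norm_num : Nat.Prime 5)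
  exact depthRowZero_vanishes_printKN_of_intModel_certificate intModel h372 not_hasCM
    KernelCerts002.C707a1.two_le_rank 5 (by norm_num) hasSurjectiveModNGaloisRep_pow_5 K hK hD
    (by norm_num) (by norm_num) heegner_neg19
    (Δ₀ := 4949) (by decide +kernel) (B := 11) (by decide +kernel) (by decide +kernel)
    (fun _ _ ↦ Or.inl (by norm_num)) Dt β ι d

end C707a1

namespace C794a1

/-- **DEPTH-ZERO VANISHING ROW `794a1`, `(p, d_K) = (5, -23)` — NO bit.** For `E = 794a1` (rank `2`, two
independent points certified in the kernel), ANY imaginary quadratic `K` with `d_K = -23`, any frame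
`(Dt, β, ι)` and ANY Kolyvagin–Heegner datum `d` of conductor `1`, granted the ONE Literature fact (γ) =
Gross 1991 Prop. 3.7 (2): the depth-0 class VANISHES, `d.kolyvaginClass _ 1 = 0` — the class of the Heegner
point `y_K` dies in `H¹(K, E[5])` (depth `0 ≤ rank − 2`; `depthRowZero_vanishes_printKN_of_intModel_certificate`,
side conditions = the kernel certificates of the bit row `depthRow_5_neg23_89_print`). CONDITIONAL on (γ);
per-curve; BSD is not proved by it. [cite: Kolyvagin1991MathAnn, Thm. 2.3 and Thm. 4]
[cite: GrossLMS1991, Prop. 3.7 (2), §4 (P_1 = y_K), §10] [cite: CremonaAlgorithms1997, Table 1 (794a1)] -/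
theorem depthRowZero_vanishes_5_neg23_printKN
    (h372 : GrossLMS1991.prop37_2_frobeniusCongruence)
    (K : Type) [Field K] [NumberField K] (hK : IsImaginaryQuadratic K)
    (hD : NumberField.discr K = -23) :
    haveI := isElliptic_c794a1;
    haveI := isGloballyMinimal_c794a1;
    haveI : NeZero (((⟨1, 0, 1, -3, 2⟩ : WeierstrassCurve ℤ).map (Int.castRingHom ℚ)).conductorNorm ℤ) :=
      neZero_conductorNorm_of_isElliptic _;
    ∀ (Dt : ModularParametrizationData ((⟨1, 0, 1, -3, 2⟩ : WeierstrassCurve ℤ).map (Int.castRingHom ℚ))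
        (((⟨1, 0, 1, -3, 2⟩ : WeierstrassCurve ℤ).map (Int.castRingHom ℚ)).conductorNorm ℤ)) (β : ℤ)
      (ι : K →+* ℂ) (d : KolyvaginHeegnerData Dt β ι 1),
    d.kolyvaginClass (p := 5) (by norm_num) 1 = 0 := by
  haveI := isElliptic_c794a1
  haveI := isGloballyMinimal_c794a1
  haveI : NeZero (((⟨1, 0, 1, -3, 2⟩ : WeierstrassCurve ℤ).map (Int.castRingHom ℚ)).conductorNorm ℤ) :=
    neZero_conductorNorm_of_isElliptic _
  intro Dt β ι d
  haveI := Fact.mk (by norm_num : Nat.Prime 5)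
  exact depthRowZero_vanishes_printKN_of_intModel_certificate intModel h372 not_hasCM
    KernelCerts002.C794a1.two_le_rank 5 (by norm_num) hasSurjectiveModNGaloisRep_pow_5 K hK hD
    (by norm_num) (by norm_num) heegner_neg23
    (Δ₀ := -1588) (by decide +kernel) (B := 11) (by decide +kernel) (by decide +kernel)
    (fun _ _ ↦ Or.inl (by norm_num)) Dt β ι d

end C794a1

namespace C817a1

/-- **DEPTH-ZERO VANISHING ROW `817a1`, `(p, d_K) = (5, -8)` — NO bit.** For `E = 817a1` (rank `2`, two
independent points certified in the kernel), ANY imaginary quadratic `K` with `d_K = -8`, any frame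
`(Dt, β, ι)` and ANY Kolyvagin–Heegner datum `d` of conductor `1`, granted the ONE Literature fact (γ) =
Gross 1991 Prop. 3.7 (2): the depth-0 class VANISHES, `d.kolyvaginClass _ 1 = 0` — the class of the Heegner
point `y_K` dies in `H¹(K, E[5])` (depth `0 ≤ rank − 2`; `depthRowZero_vanishes_printKN_of_intModel_certificate`,
side conditions = the kernel certificates of the bit row `depthRow_5_neg8_239_print`). CONDITIONAL on (γ);
per-curve; BSD is not proved by it. [cite: Kolyvagin1991MathAnn, Thm. 2.3 and Thm. 4]
[cite: GrossLMS1991, Prop. 3.7 (2), §4 (P_1 = y_K), §10] [cite: CremonaAlgorithms1997, Table 1 (817a1)] -/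
theorem depthRowZero_vanishes_5_neg8_printKN
    (h372 : GrossLMS1991.prop37_2_frobeniusCongruence)
    (K : Type) [Field K] [NumberField K] (hK : IsImaginaryQuadratic K)
    (hD : NumberField.discr K = -8) :
    haveI := isElliptic_c817a1;
    haveI := isGloballyMinimal_c817a1;
    haveI : NeZero (((⟨0, 1, 1, 1, 6⟩ : WeierstrassCurve ℤ).map (Int.castRingHom ℚ)).conductorNorm ℤ) :=
      neZero_conductorNorm_of_isElliptic _;
    ∀ (Dt : ModularParametrizationData ((⟨0, 1, 1, 1, 6⟩ : WeierstrassCurve ℤ).map (Int.castRingHom ℚ))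
        (((⟨0, 1, 1, 1, 6⟩ : WeierstrassCurve ℤ).map (Int.castRingHom ℚ)).conductorNorm ℤ)) (β : ℤ)
      (ι : K →+* ℂ) (d : KolyvaginHeegnerData Dt β ι 1),
    d.kolyvaginClass (p := 5) (by norm_num) 1 = 0 := by
  haveI := isElliptic_c817a1
  haveI := isGloballyMinimal_c817a1
  haveI : NeZero (((⟨0, 1, 1, 1, 6⟩ : WeierstrassCurve ℤ).map (Int.castRingHom ℚ)).conductorNorm ℤ) :=
    neZero_conductorNorm_of_isElliptic _
  intro Dt β ι d
  haveI := Fact.mk (by norm_num : Nat.Prime 5)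
  exact depthRowZero_vanishes_printKN_of_intModel_certificate intModel h372 not_hasCM
    KernelCertsR01.C817a1.two_le_rank 5 (by norm_num) hasSurjectiveModNGaloisRep_pow_5 K hK hD
    (by norm_num) (by norm_num) heegner_neg8
    (Δ₀ := -15523) (by decide +kernel) (B := 11) (by decide +kernel) (by decide +kernel)
    (fun _ _ ↦ Or.inl (by norm_num)) Dt β ι d

end C817a1

namespace C997b1

/-- **DEPTH-ZERO VANISHING ROW `997b1`, `(p, d_K) = (5, -52)` — NO bit.** For `E = 997b1` (rank `2`, two
independent points certified in the kernel), ANY imaginary quadratic `K` with `d_K = -52`, any frame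
`(Dt, β, ι)` and ANY Kolyvagin–Heegner datum `d` of conductor `1`, granted the ONE Literature fact (γ) =
Gross 1991 Prop. 3.7 (2): the depth-0 class VANISHES, `d.kolyvaginClass _ 1 = 0` — the class of the Heegner
point `y_K` dies in `H¹(K, E[5])` (depth `0 ≤ rank − 2`; `depthRowZero_vanishes_printKN_of_intModel_certificate`,
side conditions = the kernel certificates of the bit row `depthRow_5_neg52_199_print`). CONDITIONAL on (γ);
per-curve; BSD is not proved by it. [cite: Kolyvagin1991MathAnn, Thm. 2.3 and Thm. 4]
[cite: GrossLMS1991, Prop. 3.7 (2), §4 (P_1 = y_K), §10] [cite: CremonaAlgorithms1997, Table 1 (997b1)] -/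
theorem depthRowZero_vanishes_5_neg52_printKN
    (h372 : GrossLMS1991.prop37_2_frobeniusCongruence)
    (K : Type) [Field K] [NumberField K] (hK : IsImaginaryQuadratic K)
    (hD : NumberField.discr K = -52) :
    haveI := isElliptic_c997b1;
    haveI := isGloballyMinimal_c997b1;
    haveI : NeZero (((⟨0, -1, 1, -5, -3⟩ : WeierstrassCurve ℤ).map (Int.castRingHom ℚ)).conductorNorm ℤ) :=
      neZero_conductorNorm_of_isElliptic _;
    ∀ (Dt : ModularParametrizationData ((⟨0, -1, 1, -5, -3⟩ : WeierstrassCurve ℤ).map (Int.castRingHom ℚ))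
        (((⟨0, -1, 1, -5, -3⟩ : WeierstrassCurve ℤ).map (Int.castRingHom ℚ)).conductorNorm ℤ)) (β : ℤ)
      (ι : K →+* ℂ) (d : KolyvaginHeegnerData Dt β ι 1),
    d.kolyvaginClass (p := 5) (by norm_num) 1 = 0 := by
  haveI := isElliptic_c997b1
  haveI := isGloballyMinimal_c997b1
  haveI : NeZero (((⟨0, -1, 1, -5, -3⟩ : WeierstrassCurve ℤ).map (Int.castRingHom ℚ)).conductorNorm ℤ) :=
    neZero_conductorNorm_of_isElliptic _
  intro Dt β ι d
  haveI := Fact.mk (by norm_num : Nat.Prime 5)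
  exact depthRowZero_vanishes_printKN_of_intModel_certificate intModel h372 not_hasCM
    KernelCertsR01.C997b1.two_le_rank 5 (by norm_num) hasSurjectiveModNGaloisRep_pow_5 K hK hD
    (by norm_num) (by norm_num) heegner_neg52
    (Δ₀ := 997) (by decide +kernel) (B := 11) (by decide +kernel) (by decide +kernel)
    (fun _ _ ↦ Or.inl (by norm_num)) Dt β ι d

end C997b1

namespace C997c1

/-- **DEPTH-ZERO VANISHING ROW `997c1`, `(p, d_K) = (5, -67)` — NO bit.** For `E = 997c1` (rank `2`, two
independent points certified in the kernel), ANY imaginary quadratic `K` with `d_K = -67`, any frame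
`(Dt, β, ι)` and ANY Kolyvagin–Heegner datum `d` of conductor `1`, granted the ONE Literature fact (γ) =
Gross 1991 Prop. 3.7 (2): the depth-0 class VANISHES, `d.kolyvaginClass _ 1 = 0` — the class of the Heegner
point `y_K` dies in `H¹(K, E[5])` (depth `0 ≤ rank − 2`; `depthRowZero_vanishes_printKN_of_intModel_certificate`,
side conditions = the kernel certificates of the bit row `depthRow_5_neg67_229_print`). CONDITIONAL on (γ);
per-curve; BSD is not proved by it. [cite: Kolyvagin1991MathAnn, Thm. 2.3 and Thm. 4]
[cite: GrossLMS1991, Prop. 3.7 (2), §4 (P_1 = y_K), §10] [cite: CremonaAlgorithms1997, Table 1 (997c1)] -/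
theorem depthRowZero_vanishes_5_neg67_printKN
    (h372 : GrossLMS1991.prop37_2_frobeniusCongruence)
    (K : Type) [Field K] [NumberField K] (hK : IsImaginaryQuadratic K)
    (hD : NumberField.discr K = -67) :
    haveI := isElliptic_c997c1;
    haveI := isGloballyMinimal_c997c1;
    haveI : NeZero (((⟨0, -1, 1, -24, 54⟩ : WeierstrassCurve ℤ).map (Int.castRingHom ℚ)).conductorNorm ℤ) :=
      neZero_conductorNorm_of_isElliptic _;
    ∀ (Dt : ModularParametrizationData ((⟨0, -1, 1, -24, 54⟩ : WeierstrassCurve ℤ).map (Int.castRingHom ℚ))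
        (((⟨0, -1, 1, -24, 54⟩ : WeierstrassCurve ℤ).map (Int.castRingHom ℚ)).conductorNorm ℤ)) (β : ℤ)
      (ι : K →+* ℂ) (d : KolyvaginHeegnerData Dt β ι 1),
    d.kolyvaginClass (p := 5) (by norm_num) 1 = 0 := by
  haveI := isElliptic_c997c1
  haveI := isGloballyMinimal_c997c1
  haveI : NeZero (((⟨0, -1, 1, -24, 54⟩ : WeierstrassCurve ℤ).map (Int.castRingHom ℚ)).conductorNorm ℤ) :=
    neZero_conductorNorm_of_isElliptic _
  intro Dt β ι d
  haveI := Fact.mk (by norm_num : Nat.Prime 5)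
  exact depthRowZero_vanishes_printKN_of_intModel_certificate intModel h372 not_hasCM
    KernelCerts003.C997c1.two_le_rank 5 (by norm_num) hasSurjectiveModNGaloisRep_pow_5 K hK hD
    (by norm_num) (by norm_num) heegner_neg67
    (Δ₀ := 997) (by decide +kernel) (B := 11) (by decide +kernel) (by decide +kernel)
    (fun _ _ ↦ Or.inl (by norm_num)) Dt β ι d

end C997c1

namespace C664a1

/-- **DEPTH-ZERO VANISHING ROW `664a1`, `(p, d_K) = (5, -39)` — NO bit.** For `E = 664a1` (rank `2`, two
independent points certified in the kernel), ANY imaginary quadratic `K` with `d_K = -39`, any frame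
`(Dt, β, ι)` and ANY Kolyvagin–Heegner datum `d` of conductor `1`, granted the ONE Literature fact (γ) =
Gross 1991 Prop. 3.7 (2): the depth-0 class VANISHES, `d.kolyvaginClass _ 1 = 0` — the class of the Heegner
point `y_K` dies in `H¹(K, E[5])` (depth `0 ≤ rank − 2`; `depthRowZero_vanishes_printKN_of_intModel_certificate`,
side conditions = the kernel certificates of the bit row `depthRow_5_neg39_29_print`). CONDITIONAL on (γ);
per-curve; BSD is not proved by it. [cite: Kolyvagin1991MathAnn, Thm. 2.3 and Thm. 4]
[cite: GrossLMS1991, Prop. 3.7 (2), §4 (P_1 = y_K), §10] [cite: CremonaAlgorithms1997, Table 1 (664a1)] -/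
theorem depthRowZero_vanishes_5_neg39_printKN
    (h372 : GrossLMS1991.prop37_2_frobeniusCongruence)
    (K : Type) [Field K] [NumberField K] (hK : IsImaginaryQuadratic K)
    (hD : NumberField.discr K = -39) :
    haveI := isElliptic_c664a1;
    haveI := isGloballyMinimal_c664a1;
    haveI : NeZero (((⟨0, 0, 0, -7, 10⟩ : WeierstrassCurve ℤ).map (Int.castRingHom ℚ)).conductorNorm ℤ) :=
      neZero_conductorNorm_of_isElliptic _;
    ∀ (Dt : ModularParametrizationData ((⟨0, 0, 0, -7, 10⟩ : WeierstrassCurve ℤ).map (Int.castRingHom ℚ))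
        (((⟨0, 0, 0, -7, 10⟩ : WeierstrassCurve ℤ).map (Int.castRingHom ℚ)).conductorNorm ℤ)) (β : ℤ)
      (ι : K →+* ℂ) (d : KolyvaginHeegnerData Dt β ι 1),
    d.kolyvaginClass (p := 5) (by norm_num) 1 = 0 := by
  haveI := isElliptic_c664a1
  haveI := isGloballyMinimal_c664a1
  haveI : NeZero (((⟨0, 0, 0, -7, 10⟩ : WeierstrassCurve ℤ).map (Int.castRingHom ℚ)).conductorNorm ℤ) :=
    neZero_conductorNorm_of_isElliptic _
  intro Dt β ι d
  haveI := Fact.mk (by norm_num : Nat.Prime 5)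
  exact depthRowZero_vanishes_printKN_of_intModel_certificate intModel h372 not_hasCM
    KernelCerts001.C664a1.two_le_rank 5 (by norm_num) hasSurjectiveModNGaloisRep_pow_5 K hK hD
    (by norm_num) (by norm_num) heegner_neg39
    (Δ₀ := -21248) (by decide +kernel) (B := 11) (by decide +kernel) (by decide +kernel)
    (fun _ _ ↦ Or.inl (by norm_num)) Dt β ι d

end C664a1

namespace C916c1

/-- **DEPTH-ZERO VANISHING ROW `916c1`, `(p, d_K) = (5, -111)` — NO bit.** For `E = 916c1` (rank `2`, two
independent points certified in the kernel), ANY imaginary quadratic `K` with `d_K = -111`, any frame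
`(Dt, β, ι)` and ANY Kolyvagin–Heegner datum `d` of conductor `1`, granted the ONE Literature fact (γ) =
Gross 1991 Prop. 3.7 (2): the depth-0 class VANISHES, `d.kolyvaginClass _ 1 = 0` — the class of the Heegner
point `y_K` dies in `H¹(K, E[5])` (depth `0 ≤ rank − 2`; `depthRowZero_vanishes_printKN_of_intModel_certificate`,
side conditions = the kernel certificates of the bit row `depthRow_5_neg111_19_print`). CONDITIONAL on (γ);
per-curve; BSD is not proved by it. [cite: Kolyvagin1991MathAnn, Thm. 2.3 and Thm. 4]
[cite: GrossLMS1991, Prop. 3.7 (2), §4 (P_1 = y_K), §10] [cite: CremonaAlgorithms1997, Table 1 (916c1)] -/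
theorem depthRowZero_vanishes_5_neg111_printKN
    (h372 : GrossLMS1991.prop37_2_frobeniusCongruence)
    (K : Type) [Field K] [NumberField K] (hK : IsImaginaryQuadratic K)
    (hD : NumberField.discr K = -111) :
    haveI := isElliptic_c916c1;
    haveI := isGloballyMinimal_c916c1;
    haveI : NeZero (((⟨0, 0, 0, -4, 1⟩ : WeierstrassCurve ℤ).map (Int.castRingHom ℚ)).conductorNorm ℤ) :=
      neZero_conductorNorm_of_isElliptic _;
    ∀ (Dt : ModularParametrizationData ((⟨0, 0, 0, -4, 1⟩ : WeierstrassCurve ℤ).map (Int.castRingHom ℚ))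
        (((⟨0, 0, 0, -4, 1⟩ : WeierstrassCurve ℤ).map (Int.castRingHom ℚ)).conductorNorm ℤ)) (β : ℤ)
      (ι : K →+* ℂ) (d : KolyvaginHeegnerData Dt β ι 1),
    d.kolyvaginClass (p := 5) (by norm_num) 1 = 0 := by
  haveI := isElliptic_c916c1
  haveI := isGloballyMinimal_c916c1
  haveI : NeZero (((⟨0, 0, 0, -4, 1⟩ : WeierstrassCurve ℤ).map (Int.castRingHom ℚ)).conductorNorm ℤ) :=
    neZero_conductorNorm_of_isElliptic _
  intro Dt β ι d
  haveI := Fact.mk (by norm_num : Nat.Prime 5)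
  exact depthRowZero_vanishes_printKN_of_intModel_certificate intModel h372 not_hasCM
    KernelCerts002.C916c1.two_le_rank 5 (by norm_num) hasSurjectiveModNGaloisRep_pow_5 K hK hD
    (by norm_num) (by norm_num) heegner_neg111
    (Δ₀ := 3664) (by decide +kernel) (B := 11) (by decide +kernel) (by decide +kernel)
    (fun _ _ ↦ Or.inl (by norm_num)) Dt β ι d

end C916c1

end Summit.BirchSwinnertonDyer.BirchSwinnertonDyer.Theorems.KolyvaginDepthDoor

end
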